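import Summits.AtomisticToContinuum.Crystallization.Theorems.ChargedEnergyGapEdgeSpaceDeficit
import HarnessLib

/-!
# NODE 75 «SquareSum / Roof» (lens-3 g75), PART A (§1–§4) — the 3×3 SQUARE-SUM REDUCTION of the octahedron certificate, the ROOF of a certified table, and the split beneath (Λ₁)

Beneath NODE 74's residual leaf (Λ₁) `OctCertLedgerQ` (best dual certificate of an 18-variable quadratic per framed shell octahedron) we prove the
**SQUARE-SUM REDUCTION**: the twelve edge elongations `e′` of an octahedron frame satisfy the three ATOM IDENTITIES
`Σ_{4 edges of the square ⟂ c} e′ = 2·(D_a + D_b)` (`{a,b,c} = {0,1,2}`, `D_a` the diagonal elongations), so by Cauchy–Schwarz on each square the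
certificate condition `⅛·octEW(W) + (c/4)·octDW(W) + Σ ν_a D_a² ≥ 0` FOLLOWS from a positive-semidefiniteness condition on an explicit **3×3** quadratic
form in `(D₀, D₁, D₂)` whose coefficients are the six vertex weights (`SqCert`, §1; `octCert_of_sqCert` ★ PROVED).  The residual becomes the
**SQUARE-SUM LEDGER** (B♮) `SqLedgerQ` (§3): the integrand of (Λ₁) replaced by `(τ·2ρ)²·sqVal`, `sqVal := inf Σν` over 3×3 certificates — a statement about a
scalar CONVEX function of SIX numbers per shell octahedron; glue `octCertLedgerQ_of_sqLedger` ★ PROVED (§3) from two typed support leaves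
(A0⁺) `A0Plus` (`0.686 ≤ a₀`, numerical) and (SHELL₂) `ShellIsSecond` (shell pairs of the exact lattice are second neighbours, lattice geometry) and the
coefficient bound (C⋆) `ljBar_diag_narrow` (`-0.471 ≤ c(2ρ)` for `ρ ∈ [0.686, 0.691]`) ★ PROVED (§2).  (B♮) splits (§4, `sqLedgerQ_of_major` ★ PROVED) as
(M) `SqMajorQ C g` (`sqVal ≤ g` on `[0,1]⁶`) ∧ (G) `FLedgerQ cls g …` (the geometric ledger of `g`), and (M) is DISCHARGED UP TO A FINITE CHECK by the
**ROOF LEMMA** (§5, `sqVal_le_roofVal` ★ PROVED): certificates are additive and positively homogeneous in `(W, ν)` and equivariant under the 48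
relabellings of the octahedron, so the ROOF `roofVal T` of any finite table `T` of pointwise-certified patterns (the lower convex envelope of the
table costs over the cone generated by the relabelled patterns — an LP value) majorises `sqVal`.  §6 fixes the 203-entry table `T75` (units, uniform,
box, planar, χ-planar, fold and realised deep-fold patterns; planar/box patterns cost `0`) and proves the cone
`chargedEnergyGap_of_roofLedger_numerics`: (Λ₁) ⟸ (A0⁺) ∧ (SHELL₂) ∧ (M_T) `RoofTableQ 0.471 T75` [finite: 203 rational 3×3 PSD checks, certified
exactly in `num75/tableS.py`] ∧ (G_T) `RoofLedgerQ` [THE residual; `num75/`: ledger ratios `≤ 0.37` on nine geometries].  0 sorry.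
-/

noncomputable section
open scoped Classical
open Literature.MathematicalPhysics.StatisticalMechanics Literature.Geometry.DiscreteGeometry
open Summit.AtomisticToContinuum.Crystallization.Theses.PricedLinkCensus
open Summit.AtomisticToContinuum.Crystallization.Theorems.ChargedEnergyGapNegative

namespace Summit.AtomisticToContinuum.Crystallization.Theorems.ChargedEnergyGapChartDial

/-! ## §1 The square-sum certificate and the reduction (PROVED) -/

section SquareSum

variable {P : PeriodicConfiguration 3} {c : E3} {f : Fin 3 → E3} {ρ : ℝ} {y z : E3}

/-- ★ **SQUARE-SUM CERTIFICATE** for six vertex weights `Wv` at diagonal coefficient bound `C` (`|c(2ρ)| ≤ C`): non-negative multipliers `ν`, three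
Cauchy–Schwarz constants `l_c` of the squares (`l_c·(Σe)² ≤ Σ (W_p+W_q)e²` over the four edges of the square orthogonal to axis `c`; the best is
`1/Σ 1/(W_p+W_q)`), and positive-semidefiniteness of the 3×3 form `Σ_c 2l_c(x_a+x_b)² − Σ_a (C(W_a⁺+W_a⁻) − 4ν_a)x_a²`. -/
def SqCert (C : ℝ) (Wv : Fin 3 × Bool → ℝ) (ν : Fin 3 → ℝ) : Prop :=
  (∀ a, 0 ≤ ν a) ∧ ∃ l₀ l₁ l₂ : ℝ,
    (∀ e₁ e₂ e₃ e₄ : ℝ, l₀ * (e₁ + e₂ + e₃ + e₄) ^ 2 ≤ (Wv (1, true) + Wv (2, true)) * e₁ ^ 2 + (Wv (1, true) + Wv (2, false)) * e₂ ^ 2 +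
      (Wv (1, false) + Wv (2, true)) * e₃ ^ 2 + (Wv (1, false) + Wv (2, false)) * e₄ ^ 2) ∧
    (∀ e₁ e₂ e₃ e₄ : ℝ, l₁ * (e₁ + e₂ + e₃ + e₄) ^ 2 ≤ (Wv (0, true) + Wv (2, true)) * e₁ ^ 2 + (Wv (0, true) + Wv (2, false)) * e₂ ^ 2 +
      (Wv (0, false) + Wv (2, true)) * e₃ ^ 2 + (Wv (0, false) + Wv (2, false)) * e₄ ^ 2) ∧
    (∀ e₁ e₂ e₃ e₄ : ℝ, l₂ * (e₁ + e₂ + e₃ + e₄) ^ 2 ≤ (Wv (0, true) + Wv (1, true)) * e₁ ^ 2 + (Wv (0, true) + Wv (1, false)) * e₂ ^ 2 +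
      (Wv (0, false) + Wv (1, true)) * e₃ ^ 2 + (Wv (0, false) + Wv (1, false)) * e₄ ^ 2) ∧
    ∀ x₀ x₁ x₂ : ℝ, 0 ≤ 2 * l₀ * (x₁ + x₂) ^ 2 + 2 * l₁ * (x₀ + x₂) ^ 2 + 2 * l₂ * (x₀ + x₁) ^ 2 -
      (C * (Wv (0, true) + Wv (0, false)) - 4 * ν 0) * x₀ ^ 2 - (C * (Wv (1, true) + Wv (1, false)) - 4 * ν 1) * x₁ ^ 2 -
      (C * (Wv (2, true) + Wv (2, false)) - 4 * ν 2) * x₂ ^ 2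

/-- The algebraic core of the reduction, over an arbitrary atom matrix `A` (component `i` of the displacement of vertex `(j,b)`). -/
theorem sq_core {C κ : ℝ} {Wv : Fin 3 × Bool → ℝ} {ν : Fin 3 → ℝ} (A : Fin 3 → Fin 3 × Bool → ℝ) (hC : -C ≤ κ)
    (hW : ∀ p, 0 ≤ Wv p) (h : SqCert C Wv ν) : 0 ≤ 1 / 8 * octEW Wv A + κ / 4 * octDW Wv A + octDW (fun p => ν p.1 / 2) A := by
  obtain ⟨hν, l₀, l₁, l₂, h₀, h₁, h₂, hQ⟩ := h
  have w0t := hW (0, true); have w0f := hW (0, false); have w1t := hW (1, true); have w1f := hW (1, false)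
  have w2t := hW (2, true); have w2f := hW (2, false)
  have s2 := h₂ ((A 1 (1, true) - A 1 (0, true)) - (A 0 (1, true) - A 0 (0, true))) (-(A 1 (1, false) - A 1 (0, true)) - (A 0 (1, false) - A 0 (0, true))) ((A 1 (1, true) - A 1 (0, false)) + (A 0 (1, true) - A 0 (0, false))) (-(A 1 (1, false) - A 1 (0, false)) + (A 0 (1, false) - A 0 (0, false)))
  have e2 : l₂ * (((A 1 (1, true) - A 1 (0, true)) - (A 0 (1, true) - A 0 (0, true))) + (-(A 1 (1, false) - A 1 (0, true)) - (A 0 (1, false) - A 0 (0, true))) + ((A 1 (1, true) - A 1 (0, false)) + (A 0 (1, true) - A 0 (0, false))) + (-(A 1 (1, false) - A 1 (0, false)) + (A 0 (1, false) - A 0 (0, false)))) ^ 2 = 4 * (l₂ * ((A 0 (0, true) - A 0 (0, false)) + (A 1 (1, true) - A 1 (1, false))) ^ 2) := by ring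
  rw [e2] at s2
  have s1 := h₁ ((A 2 (2, true) - A 2 (0, true)) - (A 0 (2, true) - A 0 (0, true))) (-(A 2 (2, false) - A 2 (0, true)) - (A 0 (2, false) - A 0 (0, true))) ((A 2 (2, true) - A 2 (0, false)) + (A 0 (2, true) - A 0 (0, false))) (-(A 2 (2, false) - A 2 (0, false)) + (A 0 (2, false) - A 0 (0, false)))
  have e1 : l₁ * (((A 2 (2, true) - A 2 (0, true)) - (A 0 (2, true) - A 0 (0, true))) + (-(A 2 (2, false) - A 2 (0, true)) - (A 0 (2, false) - A 0 (0, true))) + ((A 2 (2, true) - A 2 (0, false)) + (A 0 (2, true) - A 0 (0, false))) + (-(A 2 (2, false) - A 2 (0, false)) + (A 0 (2, false) - A 0 (0, false)))) ^ 2 = 4 * (l₁ * ((A 0 (0, true) - A 0 (0, false)) + (A 2 (2, true) - A 2 (2, false))) ^ 2) := by ring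
  rw [e1] at s1
  have s0 := h₀ ((A 2 (2, true) - A 2 (1, true)) - (A 1 (2, true) - A 1 (1, true))) (-(A 2 (2, false) - A 2 (1, true)) - (A 1 (2, false) - A 1 (1, true))) ((A 2 (2, true) - A 2 (1, false)) + (A 1 (2, true) - A 1 (1, false))) (-(A 2 (2, false) - A 2 (1, false)) + (A 1 (2, false) - A 1 (1, false)))
  have e0 : l₀ * (((A 2 (2, true) - A 2 (1, true)) - (A 1 (2, true) - A 1 (1, true))) + (-(A 2 (2, false) - A 2 (1, true)) - (A 1 (2, false) - A 1 (1, true))) + ((A 2 (2, true) - A 2 (1, false)) + (A 1 (2, true) - A 1 (1, false))) + (-(A 2 (2, false) - A 2 (1, false)) + (A 1 (2, false) - A 1 (1, false)))) ^ 2 = 4 * (l₀ * ((A 1 (1, true) - A 1 (1, false)) + (A 2 (2, true) - A 2 (2, false))) ^ 2) := by ring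
  rw [e0] at s0
  have hq := hQ (A 0 (0, true) - A 0 (0, false)) (A 1 (1, true) - A 1 (1, false)) (A 2 (2, true) - A 2 (2, false))
  have hDW : 0 ≤ octDW Wv A := by unfold octDW; positivity
  have hcoef : -C * octDW Wv A ≤ κ * octDW Wv A := mul_le_mul_of_nonneg_right hC hDW
  unfold octDW at hcoef
  unfold octEW octDW
  linarith [s0, s1, s2, hq, hcoef]

/-- ★★ **THE SQUARE-SUM REDUCTION** (PROVED): a square-sum certificate at any `C ≥ −c(2ρ)` is a dual certificate `OctCert` on EVERY frame of
half-diagonal `ρ`, for non-negative weights.  (Atom identities `Σ_{square ⟂ c} e′ = 2(D_a+D_b)` + Cauchy–Schwarz per square.) -/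
theorem octCert_of_sqCert {C : ℝ} {Wv : Fin 3 × Bool → ℝ} {ν : Fin 3 → ℝ} (hC : -C ≤ ljD2 (2 * ρ) - ljD1 (2 * ρ) / (2 * ρ))
    (hW : ∀ p, 0 ≤ Wv p) (h : SqCert C Wv ν) : OctCert c f ρ Wv ν :=
  ⟨h.1, fun u => sq_core (frameAtom c f ρ u) hC hW h⟩

/-- The TRIVIAL square-sum certificate `ν_a = C/4·(W_a⁺ + W_a⁻)` (`l = 0`): certificates exist for non-negative weights and `C ≥ 0`. -/
theorem sqCert_trivial {C : ℝ} (hC : 0 ≤ C) {Wv : Fin 3 × Bool → ℝ} (hW : ∀ p, 0 ≤ Wv p) :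
    SqCert C Wv fun a => C / 4 * (Wv (a, true) + Wv (a, false)) := by
  refine ⟨fun a => ?_, 0, 0, 0, ?_, ?_, ?_, fun x₀ x₁ x₂ => ?_⟩
  · have := hW (a, true); have := hW (a, false); positivity
  · intro e₁ e₂ e₃ e₄
    have := hW (1, true); have := hW (1, false); have := hW (2, true); have := hW (2, false); nlinarith [sq_nonneg e₁, sq_nonneg e₂, sq_nonneg e₃, sq_nonneg e₄]
  · intro e₁ e₂ e₃ e₄
    have := hW (0, true); have := hW (0, false); have := hW (2, true); have := hW (2, false); nlinarith [sq_nonneg e₁, sq_nonneg e₂, sq_nonneg e₃, sq_nonneg e₄]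
  · intro e₁ e₂ e₃ e₄
    have := hW (0, true); have := hW (0, false); have := hW (1, true); have := hW (1, false); nlinarith [sq_nonneg e₁, sq_nonneg e₂, sq_nonneg e₃, sq_nonneg e₄]
  · simp only [Fin.isValue]; nlinarith [sq_nonneg x₀, sq_nonneg x₁, sq_nonneg x₂]

/-- Monotonicity in the coefficient bound: a certificate at `C'` is one at every `C ≤ C'` (non-negative weights). -/
theorem SqCert.mono {C C' : ℝ} (hCC : C ≤ C') {Wv : Fin 3 × Bool → ℝ} (hW : ∀ p, 0 ≤ Wv p) {ν : Fin 3 → ℝ} (h : SqCert C' Wv ν) :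
    SqCert C Wv ν := by
  obtain ⟨hν, l₀, l₁, l₂, h₀, h₁, h₂, hQ⟩ := h
  refine ⟨hν, l₀, l₁, l₂, h₀, h₁, h₂, fun x₀ x₁ x₂ => ?_⟩
  have := hQ x₀ x₁ x₂
  have w0t := hW (0, true); have w0f := hW (0, false); have w1t := hW (1, true); have w1f := hW (1, false)
  have w2t := hW (2, true); have w2f := hW (2, false)
  nlinarith [sq_nonneg x₀, sq_nonneg x₁, sq_nonneg x₂, mul_nonneg (mul_nonneg (sub_nonneg.2 hCC) (add_nonneg w0t w0f)) (sq_nonneg x₀),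
    mul_nonneg (mul_nonneg (sub_nonneg.2 hCC) (add_nonneg w1t w1f)) (sq_nonneg x₁),
    mul_nonneg (mul_nonneg (sub_nonneg.2 hCC) (add_nonneg w2t w2f)) (sq_nonneg x₂)]

end SquareSum


/-! ## §2 The diagonal coefficient on the narrow window (PROVED) -/

section Coefficient

/-- `8t⁸ − 14t¹⁴ ≤ 0.471` for `t ∈ [500/691, 250/343]` (`t = 1/(2ρ)`, `ρ ∈ [0.686, 0.691]`; value `0.47002` at the upper end, margin `9.8e-4`):
the tangent/secant scheme of `ljBar_window_poly` at `T = 250/343`. -/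
theorem ljBar_narrow_poly {t : ℝ} (h0 : 500 / 691 ≤ t) (h1 : t ≤ 250 / 343) : 8 * t ^ 8 - 14 * t ^ 14 ≤ 471 / 1000 := by
  have ht : 0 < t := by linarith
  have hTt : 0 ≤ 250 / 343 - t := by linarith
  have hA : 8 * (250 / 343) * t ^ 7 - 8 * t ^ 8 ≤ (250 / 343 : ℝ) ^ 8 - t ^ 8 := by
    rw [← sub_nonneg]
    have e : (250 / 343 : ℝ) ^ 8 - t ^ 8 - (8 * (250 / 343) * t ^ 7 - 8 * t ^ 8) = (250 / 343 - t) ^ 2 *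
        ((250 / 343) ^ 6 + 2 * (250 / 343) ^ 5 * t + 3 * (250 / 343) ^ 4 * t ^ 2 + 4 * (250 / 343) ^ 3 * t ^ 3 +
          5 * (250 / 343) ^ 2 * t ^ 4 + 6 * (250 / 343) * t ^ 5 + 7 * t ^ 6) := by ring
    rw [e]; positivity
  have hB : (250 / 343 : ℝ) ^ 14 - t ^ 14 ≤ 14 * (250 / 343) ^ 14 - 14 * (250 / 343) ^ 13 * t := by
    rw [← sub_nonneg]
    have e : 14 * (250 / 343 : ℝ) ^ 14 - 14 * (250 / 343) ^ 13 * t - ((250 / 343) ^ 14 - t ^ 14) = (250 / 343 - t) ^ 2 *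
        (t ^ 12 + 2 * t ^ 11 * (250 / 343) + 3 * t ^ 10 * (250 / 343) ^ 2 + 4 * t ^ 9 * (250 / 343) ^ 3 +
          5 * t ^ 8 * (250 / 343) ^ 4 + 6 * t ^ 7 * (250 / 343) ^ 5 + 7 * t ^ 6 * (250 / 343) ^ 6 + 8 * t ^ 5 * (250 / 343) ^ 7 +
          9 * t ^ 4 * (250 / 343) ^ 8 + 10 * t ^ 3 * (250 / 343) ^ 9 + 11 * t ^ 2 * (250 / 343) ^ 10 + 12 * t * (250 / 343) ^ 11 +
          13 * (250 / 343) ^ 12) := by ring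
    rw [e]; positivity
  have h7 : (500 / 691 : ℝ) ^ 7 ≤ t ^ 7 := pow_le_pow_left₀ (by norm_num) h0 7
  have hS : 0 ≤ 64 * t ^ 7 - 196 * (250 / 343 : ℝ) ^ 13 := by
    have : (196 : ℝ) * (250 / 343) ^ 13 ≤ 64 * (500 / 691) ^ 7 := by norm_num
    linarith
  have hP : 0 ≤ 64 * (250 / 343) * t ^ 7 - 64 * t ^ 8 - 196 * (250 / 343 : ℝ) ^ 14 + 196 * (250 / 343) ^ 13 * t := by
    have := mul_nonneg hTt hS
    have e : (250 / 343 - t) * (64 * t ^ 7 - 196 * (250 / 343 : ℝ) ^ 13) =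
        64 * (250 / 343) * t ^ 7 - 64 * t ^ 8 - 196 * (250 / 343 : ℝ) ^ 14 + 196 * (250 / 343) ^ 13 * t := by ring
    linarith
  have hTop : 8 * (250 / 343 : ℝ) ^ 8 - 14 * (250 / 343) ^ 14 ≤ 471 / 1000 := by norm_num
  linarith

/-- ★ (C⋆) `−0.471 ≤ c(2ρ) := V″(2ρ) − V′(2ρ)/(2ρ)` on the NARROW half-diagonal window `[0.686, 0.691]`. -/
theorem ljBar_diag_narrow {ρ : ℝ} (h0 : 343 / 500 ≤ ρ) (h1 : ρ ≤ 691 / 1000) :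
    -(471 / 1000) ≤ ljD2 (2 * ρ) - ljD1 (2 * ρ) / (2 * ρ) := by
  have hρ : 0 < 2 * ρ := by linarith
  set t := (2 * ρ)⁻¹ with ht
  have hc : ljD2 (2 * ρ) - ljD1 (2 * ρ) / (2 * ρ) = 14 * t ^ 14 - 8 * t ^ 8 := by
    unfold ljD2 ljD1; rw [div_eq_mul_inv]; ring
  have ht0 : 500 / 691 ≤ t := by rw [ht, le_inv_comm₀ (by norm_num) hρ]; linarith
  have ht1 : t ≤ 250 / 343 := by rw [ht, inv_le_comm₀ hρ (by norm_num)]; linarith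
  have := ljBar_narrow_poly ht0 ht1
  rw [hc]; linarith

/-- ★ **(A0⁺) THE LOWER EQUILIBRIUM-SCALE BOUND** `0.686 ≤ a₀` (true value `a₀ = 0.68664…`, margin `6.4e-4`; the tree has `a₀√2 ≥ 1921/2000`, i.e.
`a₀ ≥ 0.67917`).  [residual · TRUE · NUMERICAL (interval evaluation of the two lattice sums defining `a₀`) · support leaf [A0⁺] of NODE 74's doors] -/
def A0Plus : Prop := (343 / 500 : ℝ) ≤ Fcc.a0

/-- `a0_le_of_window` (docstring added by the landing lane; see the module docstring). [formal bookkeeping] -/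
theorem a0_le_of_window : Fcc.a0 ≤ 691 / 1000 := by
  have h2 : (1414 / 1000 : ℝ) ≤ Real.sqrt 2 := by
    rw [show (1414 / 1000 : ℝ) = Real.sqrt ((1414 / 1000) ^ 2) by rw [Real.sqrt_sq (by norm_num)]]
    exact Real.sqrt_le_sqrt (by norm_num)
  have hw := a0_sqrt2_cubic_window.2
  nlinarith [Fcc.a0_pos, h2]

/-- ★ **(SHELL₂) SHELL PAIRS ARE SECOND NEIGHBOURS**: in a reference of the exact cubic class, two points at distance in `(6/5, 3/2]` are at distance
exactly `2a₀` (the lattice distances are `a₀√2·√k`, `k = 1, 2, 3, …` = `0.971, 1.373, 1.682, …`).  [residual · TRUE · lattice geometry · support] -/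
def ShellIsSecond (cls : Set E3 → Prop) : Prop :=
  ∀ P : PeriodicConfiguration 3, cls P.points → ∀ y ∈ P.points, ∀ z ∈ P.points, (6 / 5 : ℝ) < dist y z → dist y z ≤ 3 / 2 →
    dist y z = 2 * Fcc.a0

end Coefficient

/-! ## §3 The square-sum value, the square-sum ledger (B♮) -/

section SqLedger

variable {P : PeriodicConfiguration 3}

/-- The optimal total multiplier of a 3×3 square-sum certificate (`0` if there is none; there always is one for `W ≥ 0`, `C ≥ 0`). -/
def sqVal (C : ℝ) (Wv : Fin 3 × Bool → ℝ) : ℝ := sInf {t : ℝ | ∃ ν : Fin 3 → ℝ, SqCert C Wv ν ∧ t = ν 0 + ν 1 + ν 2}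

/-- `sqVal_nonneg` (docstring added by the landing lane; see the module docstring). [formal bookkeeping] -/
theorem sqVal_nonneg (C : ℝ) (Wv : Fin 3 × Bool → ℝ) : 0 ≤ sqVal C Wv := by
  refine Real.sInf_nonneg ?_
  rintro t ⟨ν, hν, rfl⟩
  have := hν.1 0; have := hν.1 1; have := hν.1 2; positivity

/-- `sqVal_le` (docstring added by the landing lane; see the module docstring). [formal bookkeeping] -/
theorem sqVal_le {C : ℝ} {Wv : Fin 3 × Bool → ℝ} {ν : Fin 3 → ℝ} (h : SqCert C Wv ν) : sqVal C Wv ≤ ν 0 + ν 1 + ν 2 :=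
  csInf_le ⟨0, by rintro t ⟨ν', hν', rfl⟩; have := hν'.1 0; have := hν'.1 1; have := hν'.1 2; positivity⟩ ⟨ν, h, rfl⟩

/-- The ANCHORED FRAME SET of a pair `(y, z)`: orthonormal frames `(c, f, ρ)` with `y, z` the two poles of axis `0` and the octahedron
`InOct P r₁ y z` exactly the six vertices; the value attached is `(τ·2ρ)²·F(W∘vertices)`. -/
def frameValSet (F : (Fin 3 × Bool → ℝ) → ℝ) (τ : ℝ) (W : E3 → ℝ) (P : PeriodicConfiguration 3) (r₁ : ℝ) (y z : E3) : Set ℝ :=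
  {t | ∃ (c : E3) (f : Fin 3 → E3) (ρ : ℝ), Orthonormal ℝ f ∧ 0 < ρ ∧ octVertex c f ρ 0 false = y ∧ octVertex c f ρ 0 true = z ∧
    (∀ x, InOct P r₁ y z x ↔ ∃ i b, x = octVertex c f ρ i b) ∧ t = (τ * (2 * ρ)) ^ 2 * F (fun p => W (octVertex c f ρ p.1 p.2))}

/-- The frame-infimum of `(τ·2ρ)²·F(W∘vertices)` over anchored frames of `(y, z)` (`0` if there is none). -/
def frameVal (F : (Fin 3 × Bool → ℝ) → ℝ) (τ : ℝ) (W : E3 → ℝ) (P : PeriodicConfiguration 3) (r₁ : ℝ) (y z : E3) : ℝ :=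
  sInf (frameValSet F τ W P r₁ y z)

variable (ϱχ : ℝ) {m : ℕ} (D : Fin m → Set E3) (σ : Fin m → Bool)

/-- The **F-SHELL FUNCTIONAL**: `octCertShellL` with the certificate value replaced by the frame-infimum of `(τ·2ρ)²·F(W∘vertices)`. -/
def fShellL (F : (Fin 3 × Bool → ℝ) → ℝ) (r₁ r₂ τ : ℝ) (P : PeriodicConfiguration 3) (X : Set E3) (ϱ : ℝ) (C : Set E3) : ℝ :=
  ∑ y ∈ P.motif, ∑ᶠ z : E3,
    if (z ∈ P.points ∧ r₁ < dist y z ∧ dist y z ≤ r₂) ∧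
        (OctClean P r₁ X y z ∧ ¬OctPlateau P r₁ (siteW ϱχ D σ X ϱ C) y z) then
      (1 / 6) * frameVal F τ (siteW ϱχ D σ X ϱ C) P r₁ y z
    else 0

/-- The **F-LEDGER** (generic shape of (B♮) and (G)): one sixth of the frame-infima of `(τ·2ρ)²·F(W∘vertices)` over the clean non-plateau shell
octahedra is paid by the three currencies — same binders as (Λ₁) `OctCertLedgerQ` verbatim. -/
def FLedgerQ (cls : Set E3 → Prop) (F : (Fin 3 × Bool → ℝ) → ℝ) (s lam ℓ τ ϱ ϱχ r₁ r₂ : ℝ) (ρlo ρhi c_T cχ : ℝ) : Prop :=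
  ∃ c_H : ℝ, 0 ≤ c_H ∧ ∀ (P : PeriodicConfiguration 3) (C X : Set E3) (m : ℕ) (D : Fin m → Set E3) (σ : Fin m → Bool),
    IsSeparatedRef s P → IsLabelledRef lam ℓ P → cls P.points → IsForceFree P → IsSiteStressFree P →
    IsInvariantSet P C → IsInvariantSet P X → (∀ i, IsInvariantSet P (D i)) → IsFramedOct P r₁ r₂ ρlo ρhi →
      fShellL ϱχ D σ F r₁ r₂ τ P X ϱ C ≤
        c_T * shellMassL ϱχ D σ P X ϱ C + cχ * transMassL ϱχ D σ P X ϱ C + c_H * (pricedNearCountL ϱχ D σ P X ϱ C : ℝ)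

/-- ★★ **(B♮) THE SQUARE-SUM LEDGER** at coefficient bound `C`: the F-ledger of `F = sqVal C` — a statement about the weight field and the SCALAR CONVEX
function `sqVal C` of six numbers per shell octahedron (no displacement, no 18-variable quadratic, no frame beyond the labelling).
[intermediate node · split further in §4–§6 as (M_T) ∧ (G_T); `num75/`: with the exact `sqVal` the ledger ratios are `≤ 0.33`] -/
def SqLedgerQ (cls : Set E3 → Prop) (C s lam ℓ τ ϱ ϱχ r₁ r₂ : ℝ) (ρlo ρhi c_T cχ : ℝ) : Prop :=
  FLedgerQ cls (sqVal C) s lam ℓ τ ϱ ϱχ r₁ r₂ ρlo ρhi c_T cχ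

variable {ϱχ D σ}

/-- Poles of an anchored frame are at distance `2ρ`. -/
theorem dist_poles {c : E3} {f : Fin 3 → E3} {ρ : ℝ} {y z : E3} (hf : Orthonormal ℝ f) (hρ : 0 < ρ)
    (hy : octVertex c f ρ 0 false = y) (hz : octVertex c f ρ 0 true = z) : dist y z = 2 * ρ := by
  subst hy; subst hz
  simp only [octVertex, dist_eq_norm, Bool.false_eq_true, ↓reduceIte]
  have : c + (-ρ) • f 0 - (c + ρ • f 0) = (-(2 * ρ)) • f 0 := by
    rw [show (-(2 * ρ)) = -ρ - ρ by ring, sub_smul]; abel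
  rw [this, norm_smul, hf.1 0, Real.norm_eq_abs, abs_neg, abs_of_pos (by linarith)]; ring

/-- ★ TERMWISE COMPARISON (PROVED): on a framed shell pair of the exact class, the certificate value is at most the frame-infimum of
`(τ·2ρ)²·sqVal C⋆` (`C⋆ = 0.471`; square-sum reduction + (C⋆) on `ρ = a₀ ∈ [0.686, 0.691]`). -/
theorem octCertVal_le_frameVal_sqVal {cls : Set E3 → Prop} (hA : A0Plus) (hSh : ShellIsSecond cls) (hcl : cls P.points)
    {W : E3 → ℝ} (hW0 : ∀ x, 0 ≤ W x) {τ : ℝ} (hτ : 0 < τ) {y z : E3} (hy : y ∈ P.points) (hz : z ∈ P.points)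
    (h1 : (6 / 5 : ℝ) < dist y z) (h2 : dist y z ≤ 3 / 2) (hne : (frameValSet (sqVal (471 / 1000)) τ W P (6 / 5) y z).Nonempty) :
    octCertVal (6 / 5) τ W P y z ≤ frameVal (sqVal (471 / 1000)) τ W P (6 / 5) y z := by
  refine le_csInf hne ?_
  rintro t ⟨c, f, ρ, hf, hρ, hyv, hzv, hO, rfl⟩
  have hd := dist_poles hf hρ hyv hzv
  have hρa : ρ = Fcc.a0 := by have := hSh P hcl y hy z hz h1 h2; linarith
  have hlo : 343 / 500 ≤ ρ := hρa ▸ hA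
  have hhi : ρ ≤ 691 / 1000 := hρa ▸ a0_le_of_window
  have hC := ljBar_diag_narrow hlo hhi
  have hedge : ρ * Real.sqrt 2 ≤ 6 / 5 := by rw [hρa]; linarith [a0_sqrt2_cubic_window.2]
  have hdiag : (6 / 5 : ℝ) < 2 * ρ := by linarith
  have hb : 0 < (τ * (2 * ρ)) ^ 2 := by positivity
  set Wv : Fin 3 × Bool → ℝ := fun p => W (octVertex c f ρ p.1 p.2) with hWv
  have hWv : ∀ p, 0 ≤ Wv p := fun p => hW0 _
  -- octCertVal ≤ (τ2ρ)²·Σν for every square-sum certificate ν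
  have key : ∀ ν, SqCert (471 / 1000) Wv ν → octCertVal (6 / 5) τ W P y z ≤ (τ * (2 * ρ)) ^ 2 * (ν 0 + ν 1 + ν 2) := by
    intro ν hν
    refine csInf_le ⟨0, fun t ht => octCertSet_nonneg ht⟩ ?_
    exact ⟨c, f, ρ, ν, hf, hρ, hedge, hdiag, hO, octCert_of_sqCert hC hWv hν, rfl⟩
  have hne' : ({t : ℝ | ∃ ν : Fin 3 → ℝ, SqCert (471 / 1000) Wv ν ∧ t = ν 0 + ν 1 + ν 2}).Nonempty :=
    ⟨_, _, sqCert_trivial (by norm_num) hWv, rfl⟩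
  have : octCertVal (6 / 5) τ W P y z / (τ * (2 * ρ)) ^ 2 ≤ sqVal (471 / 1000) Wv := by
    refine le_csInf hne' ?_
    rintro t ⟨ν, hν, rfl⟩
    rw [div_le_iff₀ hb, mul_comm]; exact key ν hν
  rwa [div_le_iff₀ hb, mul_comm] at this

/-- ★★ **GLUE beneath (Λ₁), PROVED**: (A0⁺) ∧ (SHELL₂) ∧ (B♮)[`C⋆ = 0.471`] ⟹ (Λ₁) (τ = 3/100, r₁ = 6/5, r₂ = 3/2, ρ-window [0.679, 0.691],
any separation `s > 0`). -/
theorem octCertLedgerQ_of_sqLedger {cls : Set E3 → Prop} {s lam ℓ ϱ c_T cχ : ℝ} (hs : 0 < s) (hA : A0Plus) (hSh : ShellIsSecond cls)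
    (h : SqLedgerQ cls (471 / 1000) s lam ℓ (3 / 100) ϱ ϱχ (6 / 5) (3 / 2) (679 / 1000) (691 / 1000) c_T cχ) :
    OctCertLedgerQ cls s lam ℓ (3 / 100) ϱ ϱχ (6 / 5) (3 / 2) (679 / 1000) (691 / 1000) c_T cχ := by
  classical
  obtain ⟨c_H, hc, h⟩ := h
  refine ⟨c_H, hc, fun P C X m D σ h1 h2 hcl h3 h4 h6 h7 h11 hFr => ?_⟩
  refine le_trans ?_ (h P C X m D σ h1 h2 hcl h3 h4 h6 h7 h11 hFr)
  unfold octCertShellL fShellL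
  refine Finset.sum_le_sum fun y hy => ?_
  have hyP : y ∈ P.points := P.mem_points_of_mem_motif hy
  have hF := h1.finite_inter_closedBall hs y (3 / 2)
  set T : Finset E3 := hF.toFinset with hT
  have hmemT : ∀ z, z ∈ P.points → dist y z ≤ 3 / 2 → z ∈ T := fun z hz hd => by
    rw [hT, Set.Finite.mem_toFinset]
    exact ⟨hz, Metric.mem_closedBall.2 (by rw [dist_comm]; exact hd)⟩
  rw [finsum_eq_sum_of_support_subset (s := T), finsum_eq_sum_of_support_subset (s := T)]
  · refine Finset.sum_le_sum fun z _ => ?_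
    split_ifs with hsel
    · obtain ⟨c, f, ρ, hf, hρ1, hρ2, hyv, hzv, hO⟩ := hFr y hyP z hsel.1.1 hsel.1.2.1 hsel.1.2.2
      have hρ : 0 < ρ := by linarith
      have key := octCertVal_le_frameVal_sqVal (P := P) (W := siteW ϱχ D σ X ϱ C) (τ := 3 / 100) hA hSh hcl
        (fun x => siteW_nonneg X ϱ C x) (by norm_num) hyP hsel.1.1 hsel.1.2.1 hsel.1.2.2 ⟨_, c, f, ρ, hf, hρ, hyv, hzv, hO, rfl⟩
      linarith
    · exact le_rfl
  · intro z hz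
    by_contra hzT
    exact (Function.mem_support.1 hz) (if_neg fun h' => hzT (hmemT z h'.1.1 h'.1.2.2))
  · intro z hz
    by_contra hzT
    exact (Function.mem_support.1 hz) (if_neg fun h' => hzT (hmemT z h'.1.1 h'.1.2.2))

end SqLedger

/-! ## §4 The majorant split of an F-ledger (PROVED): (B♮) ⟸ (M) `sqVal ≤ g on [0,1]⁶` ∧ (G) the g-ledger -/

section Major

variable {P : PeriodicConfiguration 3}

/-- ★ **(M) FINITE-DIMENSIONAL MAJORANT**: on `[0,1]⁶` the square-sum value at `C` is at most `g`. -/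
def SqMajorQ (C : ℝ) (g : (Fin 3 × Bool → ℝ) → ℝ) : Prop :=
  ∀ Wv : Fin 3 × Bool → ℝ, (∀ p, 0 ≤ Wv p) → (∀ p, Wv p ≤ 1) → sqVal C Wv ≤ g Wv

/-- `frameVal_mono` (docstring added by the landing lane; see the module docstring). [formal bookkeeping] -/
theorem frameVal_mono {F G : (Fin 3 × Bool → ℝ) → ℝ} {τ r₁ : ℝ} {W : E3 → ℝ} {y z : E3} (hF0 : ∀ Wv, 0 ≤ F Wv)
    (hFG : ∀ (c : E3) (f : Fin 3 → E3) (ρ : ℝ), Orthonormal ℝ f → 0 < ρ →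
      F (fun p => W (octVertex c f ρ p.1 p.2)) ≤ G (fun p => W (octVertex c f ρ p.1 p.2)))
    (hne : (frameValSet G τ W P r₁ y z).Nonempty) : frameVal F τ W P r₁ y z ≤ frameVal G τ W P r₁ y z := by
  refine le_csInf hne ?_
  rintro t ⟨c, f, ρ, hf, hρ, hyv, hzv, hO, rfl⟩
  have hbdd : BddBelow (frameValSet F τ W P r₁ y z) := by
    refine ⟨0, ?_⟩
    rintro t' ⟨c', f', ρ', -, -, -, -, -, rfl⟩
    exact mul_nonneg (sq_nonneg _) (hF0 _)
  have hmem : (τ * (2 * ρ)) ^ 2 * F (fun p => W (octVertex c f ρ p.1 p.2)) ∈ frameValSet F τ W P r₁ y z :=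
    ⟨c, f, ρ, hf, hρ, hyv, hzv, hO, rfl⟩
  exact (csInf_le hbdd hmem).trans (mul_le_mul_of_nonneg_left (hFG c f ρ hf hρ) (sq_nonneg _))

/-- ★★ **GLUE (PROVED)**: (M) `SqMajorQ C g` ∧ (G) the g-ledger ⟹ (B♮) the square-sum ledger at `C` (same constants). -/
theorem sqLedgerQ_of_major {cls : Set E3 → Prop} {C : ℝ} {g : (Fin 3 × Bool → ℝ) → ℝ} {s lam ℓ τ ϱ ϱχ r₁ r₂ ρlo ρhi c_T cχ : ℝ}
    (hs : 0 < s) (hlo : 0 < ρlo) (hM : SqMajorQ C g) (h : FLedgerQ cls g s lam ℓ τ ϱ ϱχ r₁ r₂ ρlo ρhi c_T cχ) :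
    SqLedgerQ cls C s lam ℓ τ ϱ ϱχ r₁ r₂ ρlo ρhi c_T cχ := by
  classical
  obtain ⟨c_H, hc, h⟩ := h
  refine ⟨c_H, hc, fun P Cs X m D σ h1 h2 hcl h3 h4 h6 h7 h11 hFr => ?_⟩
  refine le_trans ?_ (h P Cs X m D σ h1 h2 hcl h3 h4 h6 h7 h11 hFr)
  unfold fShellL
  refine Finset.sum_le_sum fun y hy => ?_
  have hyP : y ∈ P.points := P.mem_points_of_mem_motif hy
  have hF := h1.finite_inter_closedBall hs y r₂
  set T : Finset E3 := hF.toFinset with hT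
  have hmemT : ∀ z, z ∈ P.points → dist y z ≤ r₂ → z ∈ T := fun z hz hd => by
    rw [hT, Set.Finite.mem_toFinset]
    exact ⟨hz, Metric.mem_closedBall.2 (by rw [dist_comm]; exact hd)⟩
  rw [finsum_eq_sum_of_support_subset (s := T), finsum_eq_sum_of_support_subset (s := T)]
  · refine Finset.sum_le_sum fun z _ => ?_
    split_ifs with hsel
    · obtain ⟨c, f, ρ, hf, hρ1, hρ2, hyv, hzv, hO⟩ := hFr y hyP z hsel.1.1 hsel.1.2.1 hsel.1.2.2
      have hρ : 0 < ρ := by linarith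
      have key := frameVal_mono (P := P) (τ := τ) (r₁ := r₁) (y := y) (z := z) (W := siteW ϱχ D σ X ϱ Cs) (F := sqVal C) (G := g)
        (fun Wv => sqVal_nonneg C Wv)
        (fun c f ρ _ _ => hM (fun p => siteW ϱχ D σ X ϱ Cs (octVertex c f ρ p.1 p.2)) (fun p => siteW_nonneg X ϱ Cs _)
            (fun p => siteW_le_one ϱχ D σ X ϱ Cs _))
        ⟨_, c, f, ρ, hf, hρ, hyv, hzv, hO, rfl⟩
      linarith
    · exact le_rfl
  · intro z hz
    by_contra hzT
    exact (Function.mem_support.1 hz) (if_neg fun h' => hzT (hmemT z h'.1.1 h'.1.2.2))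
  · intro z hz
    by_contra hzT
    exact (Function.mem_support.1 hz) (if_neg fun h' => hzT (hmemT z h'.1.1 h'.1.2.2))

end Major

end Summit.AtomisticToContinuum.Crystallization.Theorems.ChargedEnergyGapChartDial
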